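import Summits.CriticalPhenomena.Ising3DConformalLimit.Theses.CoerciveSharpness
import Summits.CriticalPhenomena.Ising3DConformalLimit.Theorems.CoerciveSharpnessWindowOfGrowth
import Literature.Probability.LatticeModels.PointwiseScalingLimitEtaExists
import HarnessLib

/-!
# `WindowOfGrowthPotter_special` — the compiled witness (F3): the proved floor
# `CoerciveSharpness.WindowOfGrowth` is LITERALLY the instance `H = HasIsingEtaBounds 3` of the graded family
# `WindowOfGrowthUnder H`, whose instance `H = PotterAxis` is the rung `WindowOfGrowthPotter`

Sorry-free certificate accompanying the skeleton `Lines/WindowOfGrowthPotter.lean` (crux dir of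
`DimensionPinned`, item stmt-CriticalPhenomena-4662; forward generator G1 from the seed
`Summit.CriticalPhenomena.Ising3DConformalLimit.Theorems.windowOfGrowth_proof`). The definitions below are
VERBATIM mirrors, in the sub-namespace `…PotterWindow.Special`, of the canonical ones in the skeleton module
(namespace `…PotterWindow`; the skeleton module also contains this very `special_floor`, sorry-free, axioms
propext / Classical.choice / Quot.sound) — mirrored only because a freshly written crux module cannot be imported
on the farm within the same session; `example : PotterWindow.WindowOfGrowthUnder = PotterWindow.Special.WindowOfGrowthUnder := rfl`
once both modules are built.

* `special_floor  : WindowOfGrowthUnder (HasIsingEtaBounds 3)` — `:= windowOfGrowth_proof` after `unfold` (F3);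
* `floor_of_rung  : WindowOfGrowthPotter → CoerciveSharpness.WindowOfGrowth` (F1: the rung is the floor with its
  hypothesis strictly generalised; `potterAxis_of_hasIsingEtaBounds`: pure two-sided bounds are Potter bounds with a
  `θ`-independent constant `C/c`).
-/

noncomputable section

namespace Summit.CriticalPhenomena.Ising3DConformalLimit.Cruxes.DimensionPinned.PotterWindow.Special

open scoped BigOperators
open Finset
open Literature.Probability.LatticeModels
open Summit.CriticalPhenomena.Ising3DConformalLimit.Theses.CoerciveSharpness
open Summit.CriticalPhenomena.Ising3DConformalLimit.Theorems

/-- **Potter bounds along the axis with index `-(1+η)`** (equal Matuszewska indices of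
`m ↦ ⟨σ₀σ_{me₁}⟩_{β_c(3)}`): for every `θ > 0` there is `A > 0` with
`A⁻¹ (n/m)^{-(1+η+θ)} g(m) ≤ g(n) ≤ A (n/m)^{-(1+η-θ)} g(m)` for all `1 ≤ m ≤ n`.
[cite: BinghamGoldieTeugels1987, §1.5 (Potter's theorem) and §2.1–2.2 (Matuszewska indices, Potter-type bounds)] -/
def PotterAxis (η : ℝ) : Prop :=
  ∀ θ : ℝ, 0 < θ → ∃ A : ℝ, 0 < A ∧ ∀ m n : ℕ, 1 ≤ m → m ≤ n →
    A⁻¹ * ((n : ℝ) / m) ^ (-(1 + η + θ)) * criticalTwoPoint 3 (Pi.single 0 (m : ℤ)) ≤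
        criticalTwoPoint 3 (Pi.single 0 (n : ℤ)) ∧
      criticalTwoPoint 3 (Pi.single 0 (n : ℤ)) ≤
        A * ((n : ℝ) / m) ^ (-(1 + η - θ)) * criticalTwoPoint 3 (Pi.single 0 (m : ℤ))

/-- **The graded family** `WindowOfGrowthUnder H`: growth `n^{κ'}` of the reflected gradient and
`∃ η, H η` force the WINDOW (item stmt-CriticalPhenomena-5507 verbatim). Antitone in `H`; the floor is
`H = HasIsingEtaBounds 3` (definitionally `CoerciveSharpness.WindowOfGrowth`). -/
def WindowOfGrowthUnder (H : ℝ → Prop) : Prop :=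
  (∃ κ' c₀ : ℝ, 0 < κ' ∧ 0 < c₀ ∧ ∃ N₀ : ℕ, ∀ n : ℕ, N₀ ≤ n → c₀ * (n : ℝ) ^ κ' ≤ ∑ x ∈ box 3 n, ∑ i : Fin 3, ((if x + Pi.single i 1 ∈ box 3 n then (twoPointFree 3 (criticalBeta 3) x - twoPointFree 3 (criticalBeta 3) (Function.update x (0 : Fin 3) (2 * (n : ℤ) - x 0))) * freeExpect 3 (criticalBeta 3) 0 (spinPair (x + Pi.single i 1) (Function.update (x + Pi.single i 1) (0 : Fin 3) (2 * (n : ℤ) - (x + Pi.single i 1 : Site 3) 0))) else 0) + (if x - Pi.single i 1 ∈ box 3 n then (twoPointFree 3 (criticalBeta 3) x - twoPointFree 3 (criticalBeta 3) (Function.update x (0 : Fin 3) (2 * (n : ℤ) - x 0))) * freeExpect 3 (criticalBeta 3) 0 (spinPair (x - Pi.single i 1) (Function.update (x - Pi.single i 1) (0 : Fin 3) (2 * (n : ℤ) - (x - Pi.single i 1 : Site 3) 0))) else 0))) →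
    (∃ η : ℝ, H η) →
      ∃ ε c : ℝ, 0 < ε ∧ 0 < c ∧ ∀ m n : ℕ, 1 ≤ m → m ≤ n → c * ((n : ℝ) / m) ^ (-((3:ℝ) / 2 - ε)) * criticalTwoPoint 3 (Pi.single 0 (m : ℤ)) ≤ criticalTwoPoint 3 (Pi.single 0 (n : ℤ))

/-- **THE RUNG** (rung_decl): the window of growth under Potter bounds along the axis. -/
def WindowOfGrowthPotter : Prop :=
  WindowOfGrowthUnder PotterAxis

/-! ### The floor is the special case `H = HasIsingEtaBounds 3` (sorry-free; F3) and the rung implies the floor (F1) -/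

/-- **FLOOR = SPECIAL CASE.** `WindowOfGrowthUnder (HasIsingEtaBounds 3)` is, definitionally, the proved floor
`CoerciveSharpness.WindowOfGrowth` (item stmt-CriticalPhenomena-18198, `windowOfGrowth_proof`). -/
theorem special_floor : WindowOfGrowthUnder (HasIsingEtaBounds 3) := by
  unfold WindowOfGrowthUnder
  exact windowOfGrowth_proof

/-- Two-sided pure power bounds are Potter bounds with `θ`-independent constant `A = C/c`. [folklore] -/
theorem potterAxis_of_hasIsingEtaBounds {η : ℝ} (h : HasIsingEtaBounds 3 η) : PotterAxis η := by
  unfold HasIsingEtaBounds IsPowerBounded at h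
  obtain ⟨c, C, hc, hbd⟩ := h
  have he : (-(((3 : ℕ) : ℝ) - 2 + η)) = -(1 + η) := by norm_num
  have hne : ∀ k : ℕ, 1 ≤ k → (Pi.single (0 : Fin 3) (k : ℤ) : Site 3) ≠ 0 := by
    intro k hk h
    have h0 := congr_fun h 0
    simp at h0
    omega
  have hnorm : ∀ k : ℕ, ‖(Pi.single (0 : Fin 3) (k : ℤ) : Site 3)‖ = k := fun k => by
    rw [Pi.norm_single, Int.norm_natCast]
  have hlow : ∀ k : ℕ, 1 ≤ k → c * (k : ℝ) ^ (-(1 + η)) ≤ criticalTwoPoint 3 (Pi.single 0 (k : ℤ)) := by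
    intro k hk
    have h := (hbd _ (hne k hk)).1
    rwa [he, hnorm k] at h
  have hupp : ∀ k : ℕ, 1 ≤ k → criticalTwoPoint 3 (Pi.single 0 (k : ℤ)) ≤ C * (k : ℝ) ^ (-(1 + η)) := by
    intro k hk
    have h := (hbd _ (hne k hk)).2
    rwa [he, hnorm k] at h
  have hCpos : 0 < C := by
    have h1 := hlow 1 le_rfl
    have h2 := hupp 1 le_rfl
    norm_num at h1 h2
    linarith
  intro θ hθ
  refine ⟨C / c, div_pos hCpos hc, fun m n hm hmn => ?_⟩
  have hm0 : (0 : ℝ) < m := by exact_mod_cast hm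
  have hn0 : (0 : ℝ) < n := by exact_mod_cast (le_trans hm hmn)
  have hq1 : (1 : ℝ) ≤ (n : ℝ) / m := by
    rw [le_div_iff₀ hm0, one_mul]; exact_mod_cast hmn
  have hq0 : (0 : ℝ) < (n : ℝ) / m := by positivity
  -- `(n/m)^{-(1+η)} = n^{-(1+η)} / m^{-(1+η)}`
  have hsplit : ((n : ℝ) / m) ^ (-(1 + η)) = (n : ℝ) ^ (-(1 + η)) / (m : ℝ) ^ (-(1 + η)) :=
    Real.div_rpow hn0.le hm0.le _
  have hmpow : 0 < (m : ℝ) ^ (-(1 + η)) := Real.rpow_pos_of_pos hm0 _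
  have hnpow : 0 < (n : ℝ) ^ (-(1 + η)) := Real.rpow_pos_of_pos hn0 _
  have hgm := hupp m hm
  have hgm' := hlow m hm
  have hgn := hlow n (le_trans hm hmn)
  have hgn' := hupp n (le_trans hm hmn)
  have hgm0 : 0 < criticalTwoPoint 3 (Pi.single 0 (m : ℤ)) := criticalTwoPoint_axis_pos m
  constructor
  · -- lower: `(C/c)⁻¹ (n/m)^{-(1+η+θ)} g(m) ≤ (c/C) (n/m)^{-(1+η)} g(m) ≤ g(n)`
    have hmono : ((n : ℝ) / m) ^ (-(1 + η + θ)) ≤ ((n : ℝ) / m) ^ (-(1 + η)) :=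
      Real.rpow_le_rpow_of_exponent_le hq1 (by linarith)
    have hinv : (C / c)⁻¹ = c / C := by rw [inv_div]
    rw [hinv]
    calc c / C * ((n : ℝ) / m) ^ (-(1 + η + θ)) * criticalTwoPoint 3 (Pi.single 0 (m : ℤ))
        ≤ c / C * ((n : ℝ) / m) ^ (-(1 + η)) * criticalTwoPoint 3 (Pi.single 0 (m : ℤ)) := by
          refine mul_le_mul_of_nonneg_right (mul_le_mul_of_nonneg_left hmono ?_) hgm0.le
          positivity
      _ ≤ c / C * ((n : ℝ) / m) ^ (-(1 + η)) * (C * (m : ℝ) ^ (-(1 + η))) := by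
          refine mul_le_mul_of_nonneg_left hgm ?_
          positivity
      _ = c * (n : ℝ) ^ (-(1 + η)) := by
          rw [hsplit]; field_simp
      _ ≤ criticalTwoPoint 3 (Pi.single 0 (n : ℤ)) := hgn
  · -- upper: `g(n) ≤ C n^{-(1+η)} = (C/c) (n/m)^{-(1+η)} (c m^{-(1+η)}) ≤ (C/c) (n/m)^{-(1+η-θ)} g(m)`
    have hmono : ((n : ℝ) / m) ^ (-(1 + η)) ≤ ((n : ℝ) / m) ^ (-(1 + η - θ)) :=
      Real.rpow_le_rpow_of_exponent_le hq1 (by linarith)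
    calc criticalTwoPoint 3 (Pi.single 0 (n : ℤ)) ≤ C * (n : ℝ) ^ (-(1 + η)) := hgn'
      _ = C / c * ((n : ℝ) / m) ^ (-(1 + η)) * (c * (m : ℝ) ^ (-(1 + η))) := by
          rw [hsplit]; field_simp
      _ ≤ C / c * ((n : ℝ) / m) ^ (-(1 + η)) * criticalTwoPoint 3 (Pi.single 0 (m : ℤ)) := by
          refine mul_le_mul_of_nonneg_left hgm' ?_
          positivity
      _ ≤ C / c * ((n : ℝ) / m) ^ (-(1 + η - θ)) * criticalTwoPoint 3 (Pi.single 0 (m : ℤ)) := by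
          refine mul_le_mul_of_nonneg_right (mul_le_mul_of_nonneg_left hmono ?_) hgm0.le
          positivity

/-- The graded family is antitone in the hypothesis class. [folklore] -/
theorem windowOfGrowthUnder_antitone {H H' : ℝ → Prop} (hle : ∀ η, H η → H' η) :
    WindowOfGrowthUnder H' → WindowOfGrowthUnder H := by
  intro h hA hE
  obtain ⟨η, hη⟩ := hE
  exact h hA ⟨η, hle η hη⟩

/-- **RUNG ⟹ FLOOR** (F1: the rung is the floor with its hypothesis strictly generalised). -/
theorem floor_of_rung (hR : WindowOfGrowthPotter) :
    Summit.CriticalPhenomena.Ising3DConformalLimit.Theses.CoerciveSharpness.WindowOfGrowth := by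
  have h : WindowOfGrowthUnder (HasIsingEtaBounds 3) :=
    windowOfGrowthUnder_antitone (fun η hη => potterAxis_of_hasIsingEtaBounds hη) hR
  unfold WindowOfGrowthUnder at h
  exact h

end Summit.CriticalPhenomena.Ising3DConformalLimit.Cruxes.DimensionPinned.PotterWindow.Special

end
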